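import Summits.BirchSwinnertonDyer.BirchSwinnertonDyer.Theorems.ByReductionTypeAtTwoSupersingularThetaHabitatMT
import Summits.BirchSwinnertonDyer.BirchSwinnertonDyer.Theorems.ThetaPartnerAtTwoTwoTorsionCongruence
import HarnessLib

/-!
# Crux `SupersingularRankZeroAtTwo` (item stmt-BirchSwinnertonDyer-19097): the theta-habitat KIT DOOR on integer models, `Λ`-form,
# MAZUR–TATE KEYED — `KobayashiMainConjecture ∧ BSDp` at `2` for the non-CM member of a habitat pair from its CM partner, with
# TP2's K1 / the analytic transport V2 replaced by the algebraic transport halves at the pair and two finite layer certificates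
# (seat `bsd-2adic-ss-1x` GEN 5; companion of `…ThetaHabitatMT` and of GEN 3's `…ThetaHabitatKatoBothSidesKit`)

HONEST FRAMING (cells `bsd-2adic` and `bsd-wall`; HUMAN RULINGS D-0036/D-0054/D-0074): THEOREMS ONLY — no definition, no named
fact, no instance, no `sorry`; nothing about any curve is asserted beyond the displayed binders; closes nothing by itself; BSD is
NOT proved by any of this. PARTITION (D-0054): X5@2 good-ss, `a₂ = 0` THETA-HABITAT sub-row (19/208 r0 classes) × `p = 2` —
types-the-object-of (crux 19097 at the habitat classes); bears_on: K4 19097 · TP2 K1 20333 (algebraic halves only; V2 21416 NOT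
used) · RTT 20787 (kernel layer reading, BY NAME).

* `bsdp_two_baseChange_int_of_cmPartner_of_layerCertificates_at` — the door for integer models `M_E`, `M_A` and a Tschirnhaus pair
  `(q, r)` (kernel `E[2] ≅ A[2]`, `ThetaPartnerXRoute.exists_equivariant_addEquiv_geomTorsion_two_of_tschirnhaus`), via
  `SSMazurTate.bsdp_two_of_cmPartner_of_layerCertificates_at`; used by the class files `…SupersingularThetaMTClass<cls>.lean`.

References: [BDKim2009] Cor. 2.13; [Kobayashi2003] Thm. 1.2, 4.1; [Kato2004Asterisque] Thm. 12.4–12.5 (3); [BDKim2013] Cor. 3.15;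
[BurungaleFlach2024] Cor. 2; [Pollack2003] Prop. 6.18; [PollackWeston2011MT] §3.1; [AbbesUllmo1996] Thm. A; [SilvermanAEC2009] III.§1.
-/

set_option autoImplicit false
-- the Theorems namespace of this sub repeats the summit name by design (D-0017 nested layout)
set_option linter.dupNamespace false

noncomputable section

open scoped Classical Polynomial

open CongruenceSubgroup WeierstrassCurve Literature.NumberTheory.EllipticCurves
  Literature.NumberTheory.EllipticCurves.ModularForms
  Literature.NumberTheory.EllipticCurves.Rank1Residual Literature.NumberTheory.EllipticCurves.Rank1Residual.Typed
  Literature.NumberTheory.EllipticCurves.Kobayashi2003 Literature.NumberTheory.EllipticCurves.IwasawaDual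
  Literature.NumberTheory.IwasawaTheory
  ZpExtension Summit.BirchSwinnertonDyer.Rank1Residual Summit.BirchSwinnertonDyer.Rank1Residual.Supersingular
  Summit.BirchSwinnertonDyer.Rank1Residual.X5 Summit.BirchSwinnertonDyer.Rank1Residual.X5.O1
  Summit.BirchSwinnertonDyer.Rank1Residual.X5.Instances
  Summit.BirchSwinnertonDyer.BirchSwinnertonDyer.Theses.ThetaPartnerAtTwo

namespace Summit.BirchSwinnertonDyer.BirchSwinnertonDyer.Theorems
namespace SSThetaRoad

section Door

variable (ME MA : WeierstrassCurve ℤ)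
  [(ME.baseChange ℚ).IsElliptic] [(ME.baseChange ℚ).IsGloballyMinimal]
  [(MA.baseChange ℚ).IsElliptic] [(MA.baseChange ℚ).IsGloballyMinimal]

/-- **THE KIT DOOR, theta habitat, `Λ`-form, Mazur–Tate keyed.** `M_E ⊗ ℚ` with `L(E,1) ≠ 0`, good supersingular at `2`,
`a₂ = 0`; `M_A ⊗ ℚ` CM with `L(A,1) ≠ 0`, good supersingular at `2`, `a₂ = 0`; a Tschirnhaus pair `(q, r)` on the `2`-division
cubics certifying `E[2] ≅ A[2]` as Galois modules; PUB (`hmod`, `hGZK`, `h124`, `hX0`, `hBF`, `h2`); AT `E`: (2′) `hEC`, (4)ʳᵃᵗ `hCK`;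
AT `A`: (T2) `hT2A`, (μ) `hmuA`, (K4c) `hKimA`, (4)ʳᵃᵗ `hCKA`; AT THE PAIR: `μ`-transport `hmuT`, `λ`-transport `hlamT` (Matsuno local
sums `a`, `b`); CERT: the layer certificates `hMTW` (`n_W`, `ℓ_W`), `hMTA` (`n_A`, `ℓ_A`) and the transport law `hcons` ⟹
`KobayashiMainConjecture (M_E ⊗ ℚ) 2 1 ∧ BSDp (M_E ⊗ ℚ) 2` — GEN 3's `SSThetaRoad.bsdp_two_baseChange_int_of_katoBothSides_at` with
TP2's K1 `hT` (incl. the analytic transport V2) REPLACED by its algebraic halves at the pair + two finite certificates (via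
`SSMazurTate.bsdp_two_of_cmPartner_of_layerCertificates_at`). [cite: BurungaleFlach2024, Thm. 1.1 and Cor. 2]
[cite: BDKim2009, Cor. 2.13 and Prop. 2.6] [cite: Kobayashi2003, Thm. 1.2 and Thm. 4.1] [cite: Kato2004Asterisque, Thm. 12.4–12.5 (3), §15]
[cite: Pollack2003, Prop. 6.18] [cite: AbbesUllmo1996, Thm. A] [cite: BDKim2013, Cor. 3.15] [cite: SilvermanAEC2009, III.§1]
[cite: Miller2011LMS, Def. 1.1] -/
theorem bsdp_two_baseChange_int_of_cmPartner_of_layerCertificates_at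
    (hmod : nonempty_modularParametrizationData) (hGZK : rank_eq_analyticRank_of_analyticRank_le_one)
    (h124 : Kato2004.thm12_4) (hX0 : Kato2004_fineSelmerDual_isTorsion)
    (hBF : bsdTriple_of_hasCM_of_L_one_ne_zero) (h2 : realPeriodRat_eq_unit_mul_plusPeriod_two)
    (hL : (ME.baseChange ℚ).entireLFunction 1 ≠ 0)
    (hss : GoodSS (ME.baseChange ℚ) 2) (ha : (ME.baseChange ℚ).frobeniusTrace 2 = 0)
    (hAcm : (MA.baseChange ℚ).HasCM) (hLA : (MA.baseChange ℚ).entireLFunction 1 ≠ 0)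
    (hAss : GoodSS (MA.baseChange ℚ) 2) (hAa : (MA.baseChange ℚ).frobeniusTrace 2 = 0)
    (q r : ℚ[X])
    (hroot : ∀ ξ : AlgebraicClosure ℚ, Polynomial.aeval ξ (ME.baseChange ℚ).twoTorsionPolynomial.toPoly = 0 →
      Polynomial.aeval (Polynomial.aeval ξ q) (MA.baseChange ℚ).twoTorsionPolynomial.toPoly = 0)
    (hinv : ∀ ξ : AlgebraicClosure ℚ, Polynomial.aeval ξ (ME.baseChange ℚ).twoTorsionPolynomial.toPoly = 0 →
      Polynomial.aeval (Polynomial.aeval ξ q) r = ξ)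
    (hEC : ∀ (κ : ZpExtension ℚ 2) (γ : Field.absoluteGaloisGroup ℚ),
          κ.IsCyclotomic → κ.IsTopGenerator γ → Finite ((ME.baseChange ℚ).selmerGroupPInfty 2) →
          Finite (endInvariants (conjSignedSelmerInfty (ME.baseChange ℚ) κ 1 γ - 1)) ∧
            ∃ u : ℤ_[2]ˣ, (Nat.card (endInvariants (conjSignedSelmerInfty (ME.baseChange ℚ) κ 1 γ - 1)) : ℚ_[2]) =
              ((u : ℤ_[2]) : ℚ_[2]) * ((2 : ℕ) : ℚ_[2]) ^ (padicValNat 2 (ME.baseChange ℚ).tamagawaProduct) *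
                (Nat.card ((ME.baseChange ℚ).selmerGroupPInfty 2) : ℚ_[2]) *
                  (Nat.card (EndCoinvariants (conjSignedSelmerInfty (ME.baseChange ℚ) κ 1 γ - 1)) : ℚ_[2]))
    (hCK : ∀ (κ : ZpExtension ℚ 2) (γ : Field.absoluteGaloisGroup ℚ),
        κ.IsCyclotomic → κ.IsTopGenerator γ → IsCyclotomicVariable 2 γ →
        ∀ [NeZero ((ME.baseChange ℚ).conductorNorm ℤ)] (f : CuspForm (Gamma0 ((ME.baseChange ℚ).conductorNorm ℤ)) 2),
          IsNewformOf (ME.baseChange ℚ) f → ∀ (ϖ : ℚ), (ϖ : ℝ) * (ME.baseChange ℚ).realPeriodRat = plusPeriod f →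
        ∀ (Lplus Lminus : IwasawaAlgebra 2), IsPollackPair f 2 Lplus Lminus →
        ∀ (D : SignedSelmerDualData (ME.baseChange ℚ) κ γ 1) [ContinuousSMul ℤ_[2] ((ME.baseChange ℚ).tateModule 2)],
          ∃ (I : Kato2004.IwasawaH1Data (ME.baseChange ℚ) 2 κ γ) (Y : (ME.baseChange ℚ).FineSelmerDualData κ γ)
            (P : Submodule (IwasawaAlgebra 2) (IwasawaAlgebra 2))
            (loc : I.H →ₗ[IwasawaAlgebra 2] P) (toX : P →ₗ[IwasawaAlgebra 2] D.X)
            (δ : D.X →ₗ[IwasawaAlgebra 2] Y.X) (Z : Submodule (IwasawaAlgebra 2) I.H)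
            (G : IwasawaAlgebra 2),
            Function.Exact loc toX ∧ Function.Exact toX δ ∧
            G ∈ Submodule.map (P.subtype ∘ₗ loc) Z ∧
            iwasawaToPowerSeries 2 G =
              PowerSeries.C (ϖ : ℚ_[2]) * iwasawaToPowerSeries 2 (kobayashiL 1 Lplus Lminus) ∧
            (∀ 𝔭 : PrimeSpectrum (IwasawaAlgebra 2), 𝔭.asIdeal.height = 1 →
              PowerSeries.C (2 : ℤ_[2]) ∉ 𝔭.asIdeal →
              Literature.NumberTheory.EllipticCurves.Module.lengthAt (IwasawaAlgebra 2) Y.X 𝔭 ≤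
                Literature.NumberTheory.EllipticCurves.Module.lengthAt (IwasawaAlgebra 2) (I.H ⧸ Z) 𝔭))
    (hT2A : ∀ (κ : ZpExtension ℚ 2) (γ : Field.absoluteGaloisGroup ℚ), κ.IsCyclotomic → κ.IsTopGenerator γ →
      ∀ D : SignedSelmerDualData (MA.baseChange ℚ) κ γ 1, Module.IsTorsion (IwasawaAlgebra 2) D.X)
    (hmuA : ∀ (κ : ZpExtension ℚ 2) (γ : Field.absoluteGaloisGroup ℚ), κ.IsCyclotomic → κ.IsTopGenerator γ →
      ∀ D : SignedSelmerDualData (MA.baseChange ℚ) κ γ 1, D.mu = 0)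
    (hKimA : ∀ (κ : ZpExtension ℚ 2) (γ : Field.absoluteGaloisGroup ℚ), κ.IsCyclotomic → κ.IsTopGenerator γ →
      ∀ (D : SignedSelmerDualData (MA.baseChange ℚ) κ γ 1) [Module.Finite (IwasawaAlgebra 2) D.X],
        Module.IsTorsion (IwasawaAlgebra 2) D.X →
      ∀ g : IwasawaAlgebra 2, D.charIdeal = Ideal.span {g} → Finite ((MA.baseChange ℚ).selmerGroupPInfty 2) →
        ∃ u : ℤ_[2]ˣ, ((PowerSeries.constantCoeff g : ℤ_[2]) : ℚ_[2]) =
          ((u : ℤ_[2]) : ℚ_[2]) * ((2 : ℕ) : ℚ_[2]) ^ (padicValNat 2 (MA.baseChange ℚ).tamagawaProduct) *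
            (Nat.card ((MA.baseChange ℚ).selmerGroupPInfty 2) : ℚ_[2]))
    (hCKA : ∀ (κ : ZpExtension ℚ 2) (γ : Field.absoluteGaloisGroup ℚ),
        κ.IsCyclotomic → κ.IsTopGenerator γ → IsCyclotomicVariable 2 γ →
        ∀ [NeZero ((MA.baseChange ℚ).conductorNorm ℤ)] (f : CuspForm (Gamma0 ((MA.baseChange ℚ).conductorNorm ℤ)) 2),
          IsNewformOf (MA.baseChange ℚ) f → ∀ (ϖ : ℚ), (ϖ : ℝ) * (MA.baseChange ℚ).realPeriodRat = plusPeriod f →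
        ∀ (Lplus Lminus : IwasawaAlgebra 2), IsPollackPair f 2 Lplus Lminus →
        ∀ (D : SignedSelmerDualData (MA.baseChange ℚ) κ γ 1) [ContinuousSMul ℤ_[2] ((MA.baseChange ℚ).tateModule 2)],
          ∃ (I : Kato2004.IwasawaH1Data (MA.baseChange ℚ) 2 κ γ) (Y : (MA.baseChange ℚ).FineSelmerDualData κ γ)
            (P : Submodule (IwasawaAlgebra 2) (IwasawaAlgebra 2))
            (loc : I.H →ₗ[IwasawaAlgebra 2] P) (toX : P →ₗ[IwasawaAlgebra 2] D.X)
            (δ : D.X →ₗ[IwasawaAlgebra 2] Y.X) (Z : Submodule (IwasawaAlgebra 2) I.H)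
            (G : IwasawaAlgebra 2),
            Function.Exact loc toX ∧ Function.Exact toX δ ∧
            G ∈ Submodule.map (P.subtype ∘ₗ loc) Z ∧
            iwasawaToPowerSeries 2 G =
              PowerSeries.C (ϖ : ℚ_[2]) * iwasawaToPowerSeries 2 (kobayashiL 1 Lplus Lminus) ∧
            (∀ 𝔭 : PrimeSpectrum (IwasawaAlgebra 2), 𝔭.asIdeal.height = 1 →
              PowerSeries.C (2 : ℤ_[2]) ∉ 𝔭.asIdeal →
              Literature.NumberTheory.EllipticCurves.Module.lengthAt (IwasawaAlgebra 2) Y.X 𝔭 ≤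
                Literature.NumberTheory.EllipticCurves.Module.lengthAt (IwasawaAlgebra 2) (I.H ⧸ Z) 𝔭))
    (hmuT : GoodSS (ME.baseChange ℚ) 2 → (ME.baseChange ℚ).frobeniusTrace 2 = 0 →
      GoodSS (MA.baseChange ℚ) 2 → (MA.baseChange ℚ).frobeniusTrace 2 = 0 →
      (∃ e : WeierstrassCurve.geomTorsion (ME.baseChange ℚ) (2 : ℤ) ≃+ WeierstrassCurve.geomTorsion (MA.baseChange ℚ) (2 : ℤ),
        ∀ (σ : Field.absoluteGaloisGroup ℚ) (P : WeierstrassCurve.geomTorsion (ME.baseChange ℚ) (2 : ℤ)),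
          e (σ • P) = σ • e P) →
      ∀ (κ : ZpExtension ℚ 2) (γ : Field.absoluteGaloisGroup ℚ), κ.IsCyclotomic → κ.IsTopGenerator γ →
      ∀ (D : SignedSelmerDualData (ME.baseChange ℚ) κ γ 1) (D' : SignedSelmerDualData (MA.baseChange ℚ) κ γ 1)
        [Module.Finite (IwasawaAlgebra 2) D.X] [Module.Finite (IwasawaAlgebra 2) D'.X],
        Module.IsTorsion (IwasawaAlgebra 2) D.X → Module.IsTorsion (IwasawaAlgebra 2) D'.X →
        D'.mu = 0 → D.mu = 0)
    (a b : ℕ)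
    (hlamT : GoodSS (ME.baseChange ℚ) 2 → (ME.baseChange ℚ).frobeniusTrace 2 = 0 →
      GoodSS (MA.baseChange ℚ) 2 → (MA.baseChange ℚ).frobeniusTrace 2 = 0 →
      (∃ e : WeierstrassCurve.geomTorsion (ME.baseChange ℚ) (2 : ℤ) ≃+ WeierstrassCurve.geomTorsion (MA.baseChange ℚ) (2 : ℤ),
        ∀ (σ : Field.absoluteGaloisGroup ℚ) (P : WeierstrassCurve.geomTorsion (ME.baseChange ℚ) (2 : ℤ)),
          e (σ • P) = σ • e P) →
      ∀ (κ : ZpExtension ℚ 2) (γ : Field.absoluteGaloisGroup ℚ), κ.IsCyclotomic → κ.IsTopGenerator γ →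
      ∀ (D : SignedSelmerDualData (ME.baseChange ℚ) κ γ 1) (D' : SignedSelmerDualData (MA.baseChange ℚ) κ γ 1)
        [Module.Finite (IwasawaAlgebra 2) D.X] [Module.Finite (IwasawaAlgebra 2) D'.X],
        Module.IsTorsion (IwasawaAlgebra 2) D.X → Module.IsTorsion (IwasawaAlgebra 2) D'.X →
        D.mu = 0 → D'.mu = 0 → lambdaInvariant 2 D.X + a = lambdaInvariant 2 D'.X + b)
    {nW : ℕ} (hnW : Even nW) (ℓW : ℕ)
    (hMTW : ∀ [NeZero ((ME.baseChange ℚ).conductorNorm ℤ)] (f : CuspForm (Gamma0 ((ME.baseChange ℚ).conductorNorm ℤ)) 2),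
        IsNewformOf (ME.baseChange ℚ) f →
      ((mazurTateElement f 2 nW).map (algebraMap ℚ (PadicAlgCl 2))).supNorm = 1 ∧
        layerLambda ((mazurTateElement f 2 nW).map (algebraMap ℚ (PadicAlgCl 2))) = (2 ^ nW - 1) / 3 + ℓW)
    {nA : ℕ} (hnA : Even nA) (ℓA : ℕ)
    (hMTA : ∀ [NeZero ((MA.baseChange ℚ).conductorNorm ℤ)] (f : CuspForm (Gamma0 ((MA.baseChange ℚ).conductorNorm ℤ)) 2),
        IsNewformOf (MA.baseChange ℚ) f →
      ((mazurTateElement f 2 nA).map (algebraMap ℚ (PadicAlgCl 2))).supNorm = 1 ∧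
        layerLambda ((mazurTateElement f 2 nA).map (algebraMap ℚ (PadicAlgCl 2))) = (2 ^ nA - 1) / 3 + ℓA)
    (hcons : ℓW + a = ℓA + b) :
    KobayashiMainConjecture (ME.baseChange ℚ) 2 1 ∧ BSDp (ME.baseChange ℚ) 2 := by
  obtain ⟨e, he⟩ := ThetaPartnerXRoute.exists_equivariant_addEquiv_geomTorsion_two_of_tschirnhaus (K := ℚ)
    two_ne_zero (ME.baseChange ℚ) (MA.baseChange ℚ) q r hroot hinv
  exact SSMazurTate.bsdp_two_of_cmPartner_of_layerCertificates_at hmod hGZK h124 hX0 hBF h2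
    (ME.baseChange ℚ) (analyticRank_eq_zero_of_entireLFunction_one_ne_zero _ hL) hss ha
    (MA.baseChange ℚ) hAcm (analyticRank_eq_zero_of_entireLFunction_one_ne_zero _ hLA) hAss hAa e he
    hEC hCK hT2A hmuA hKimA hCKA hmuT a b hlamT hnW ℓW hMTW hnA ℓA hMTA hcons

end Door

end SSThetaRoad
end Summit.BirchSwinnertonDyer.BirchSwinnertonDyer.Theorems

end
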